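import Summits.QuantumFields.YangMills.Theses.StiffComplementSchur
import Summits.QuantumFields.YangMills.Theorems.StiffComplementSchurSchurEnclosurePrelim
import Summits.QuantumFields.YangMills.Theorems.LuscherReductionDressedRitzRitzInterlacing
import HarnessLib

/-!
# `StiffComplementSchur.SchurEnclosureP` (item stmt-QuantumFields-23303) — PROVED:
# `StiffPenalty → LastScaleKernelP → FemtoTransferGap.RunningReduction`

Route `StiffComplementSchur` (D-0145 LINE g16-A of seat ym-idea-4, rev 1; draft-by-design onto the rung leaf R2b1).  The support item
is the SCHUR ENCLOSURE: pure spectral bookkeeping over the tree's Courant–Fischer `levelValue`, turning the stiff-penalty clause PEN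
(`StiffPenalty`) and the last-scale frame (`LastScaleKernelP`: `l2`-orthonormal, `qform`-diagonal, antitone Ritz values `m_j`, one-site
RATIO matching, CAPTURE) into the two-sided level comparison `RunningReduction` (tree leaf N33).

* LOWER halves (`μ_k λ₀ ≤ e^{CΛ²/L} λ_k μ₀`): Rayleigh–Ritz on the frame (tree `RitzInterlace.ritz_le_levelValue`: `m_k ≤ λ_k`),
  CAPTURE at `j = 0` for the constant one-site function (its slow lift is `Ω`: `λ₀ ≤ e^{CΛ²/L} m₀`) and RATIO.
* UPPER halves (`λ_k μ₀ ≤ e^{CΛ²/L} μ_k λ₀`): `levelValue_le_of_pen_capture` (prelim module: slow projection + PEN + CAPTURE), with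
  `θ₊ = e^{−c/(2L)}λ₀ ≤ e^{|C_K|Λ²/L} m_k` deep in the window by the CLOSED one-site leaf (`oneSiteLevels_proof`:
  `μ_k/μ₀ ≥ e^{−(Δ_kΛ/L + C_osΛ²/L²)}` at `B = oneSiteCoupling β L`, `bareLambda B = Λ/L`), which also absorbs the additive
  `C₁(Λ²/L)λ₀μ₀ ≤ 3C₁(Λ²/L)λ₀μ_k` term; constant `C := 2|C_K| + 3|C₁|`.

HONEST FRAMING: spectral bookkeeping on rung-class leaves; the cruxes `StiffPenalty`, `LastScaleKernelP` and the leaf `RunningReduction`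
remain OPEN; nothing here is infinite volume, the continuum or the Clay problem; the YM mass gap is NOT proved.  No `sorry`, no new axiom,
no new definition.  References: [cite: ReedSimonIV1978, Thm. XIII.1]; [cite: GustafsonSigal2003, §11.1]; [cite: Luscher1983, §3].
-/

set_option autoImplicit false

noncomputable section

open MeasureTheory Filter Topology Real
open Literature.MathematicalPhysics.QuantumFieldTheory (GaugeConfig Site gaugeTransform wilsonFlow measurable_wilsonFlow)
open Literature.MathematicalPhysics.QuantumLattice (secondCountableTopology_su2)

namespace Summit.QuantumFields.YangMills.Theorems.StiffComplementSchur

open Summit.QuantumFields.YangMills.Theorems.FemtoTransferGap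
set_option maxHeartbeats 400000 in
/-- ★★ **`SchurEnclosureP` (item stmt-QuantumFields-23303): `StiffPenalty → LastScaleKernelP → RunningReduction`.**
For a level `k`: take `(c, C₁)` from the penalty, the frame constant `C_K` from the kernel item at `(k, c, C₁)` and `(C_os, B₀)` from the
CLOSED one-site leaf; with `A = |C_K|` the output constant is `C = 2A + 3|C₁|`, the level `lam0` is shrunk so that
`(2A + |Δ_k| + 2|C_os|)·2lam ≤ min(c,1)/4`, and `L₀` so large that `B = 2L³/Λ³ ≥ L/(4lam³) ≥ B₀`.  In the tree's exact vacuum `Ω`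
(`PhysL2.exists_groundState`): lower half by `RitzInterlace.ritz_le_levelValue` + CAPTURE at `j = 0` (constant one-site function) +
RATIO; upper half by `levelValue_le_of_pen_capture` with `θ₊ ≤ e^{AΛ²/L}m_k` (`stiff_below_slow`) and `μ₀ ≤ 3μ_k` from the one-site law.
[cite: ReedSimonIV1978, Thm. XIII.1] [cite: GustafsonSigal2003, §11.1] [cite: Luscher1983, §3] -/
theorem schurEnclosureP_proof : Summit.QuantumFields.YangMills.Theses.StiffComplementSchur.SchurEnclosureP := by
  intro hS hK k
  obtain ⟨c, C₁, lamS, hc, hlamS, HS⟩ := hS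
  obtain ⟨CK, lamK, hlamK, HK⟩ := hK k c C₁ hc
  obtain ⟨Cos, B₀, HOS⟩ := oneSiteLevels_proof k
  -- constants (opaque names with defining equations)
  obtain ⟨A, hA⟩ : ∃ A : ℝ, A = |CK| := ⟨_, rfl⟩
  have hA0 : 0 ≤ A := hA ▸ abs_nonneg _
  have hCKA : CK ≤ A := hA ▸ le_abs_self _
  obtain ⟨D, hD⟩ : ∃ D : ℝ, D = |levelGap k| := ⟨_, rfl⟩
  have hD0 : 0 ≤ D := hD ▸ abs_nonneg _
  have hΔD : levelGap k ≤ D := hD ▸ le_abs_self _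
  obtain ⟨Co, hCo⟩ : ∃ Co : ℝ, Co = |Cos| := ⟨_, rfl⟩
  have hCo0 : 0 ≤ Co := hCo ▸ abs_nonneg _
  have hCosCo : Cos ≤ Co := hCo ▸ le_abs_self _
  have hW0 : 0 < 2 * A + D + 2 * Co + 1 := by positivity
  have hlam1pos : 0 < min 1 (min c 1 / (8 * (2 * A + D + 2 * Co + 1))) :=
    lt_min one_pos (div_pos (lt_min hc one_pos) (by positivity))
  refine ⟨2 * A + 3 * |C₁|, min lamS (min lamK (min 1 (min c 1 / (8 * (2 * A + D + 2 * Co + 1))))),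
    lt_min hlamS (lt_min hlamK hlam1pos), ?_⟩
  intro lam hlam hlamle
  have hlamS' : lam ≤ lamS := hlamle.trans (min_le_left _ _)
  have hlamK' : lam ≤ lamK := hlamle.trans ((min_le_right _ _).trans (min_le_left _ _))
  have hlamW : lam ≤ min c 1 / (8 * (2 * A + D + 2 * Co + 1)) :=
    hlamle.trans ((min_le_right _ _).trans ((min_le_right _ _).trans (min_le_right _ _)))
  obtain ⟨LS, HS'⟩ := HS lam hlam hlamS'
  obtain ⟨LK, HK'⟩ := HK lam hlam hlamK'
  clear HS HK
  refine ⟨max LS (max LK (⌈4 * lam ^ 3 * B₀⌉₊ + 1)), ?_⟩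
  intro L _ hL β hwin
  have hLS : LS ≤ L := le_trans (le_max_left _ _) hL
  have hLK : LK ≤ L := le_trans (le_trans (le_max_left _ _) (le_max_right _ _)) hL
  have hLB : ⌈4 * lam ^ 3 * B₀⌉₊ + 1 ≤ L := le_trans (le_trans (le_max_right _ _) (le_max_right _ _)) hL
  -- window facts
  have hβ1 : (1 : ℝ) ≤ β := hwin.1
  have hβ0 : (0 : ℝ) ≤ β := zero_le_one.trans hβ1
  have hβpos : (0 : ℝ) < β := zero_lt_one.trans_le hβ1
  have hΛpos : 0 < luscherLambda β L := luscherLambda_pos_of_window hlam hwin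
  have hΛle : luscherLambda β L ≤ 2 * lam := hwin.2.2
  have hL1 : (1 : ℝ) ≤ L := by exact_mod_cast NeZero.one_le
  have hLpos : (0 : ℝ) < L := by linarith
  have hX0 : 0 ≤ luscherLambda β L ^ 2 / L := by positivity
  have hT0 : 0 < topValue su2Rep L β := topValue_su2Rep_pos L β
  -- the one-site coupling is large; one-site levels there
  have hBge : B₀ ≤ oneSiteCoupling β L :=
    B0_le_of_linear hlam (oneSiteCoupling_ge_linear hlam hwin) (by exact_mod_cast hLB)
  obtain ⟨hμ0pos, -, hOSlo⟩ := HOS (oneSiteCoupling β L) hBge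
  clear HOS
  rw [bareLambda_oneSiteCoupling hΛpos] at hOSlo
  have hμk0 : 0 ≤ levelValue su2Rep 1 (oneSiteCoupling β L) k :=
    le_trans (mul_nonneg (Real.exp_pos _).le hμ0pos.le) hOSlo
  -- smallness of the window
  obtain ⟨hsm1, hsm2⟩ := window_smallness hA0 hD0 hCo0 hc hlamW hΛpos hΛle hL1
  have hε : Real.exp (-(D * (luscherLambda β L / L) + Co * (luscherLambda β L / L) ^ 2)) ≤
      Real.exp (-(levelGap k * (luscherLambda β L / L) + Cos * (luscherLambda β L / L) ^ 2)) := by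
    rw [Real.exp_le_exp, neg_le_neg_iff]
    have hq0 : 0 ≤ luscherLambda β L / L := by positivity
    nlinarith [mul_le_mul_of_nonneg_right hΔD hq0, mul_le_mul_of_nonneg_right hCosCo (sq_nonneg (luscherLambda β L / L))]
  have hμ0le : levelValue su2Rep 1 (oneSiteCoupling β L) 0 ≤ 3 * levelValue su2Rep 1 (oneSiteCoupling β L) k := by
    have h1 : Real.exp (-1) ≤ Real.exp (-(D * (luscherLambda β L / L) + Co * (luscherLambda β L / L) ^ 2)) := by
      rw [Real.exp_le_exp]; linarith
    have h2 : Real.exp (-1) * levelValue su2Rep 1 (oneSiteCoupling β L) 0 ≤ levelValue su2Rep 1 (oneSiteCoupling β L) k :=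
      (mul_le_mul_of_nonneg_right (h1.trans hε) hμ0pos.le).trans hOSlo
    have h3 := mul_le_mul_of_nonneg_left h2 (Real.exp_pos 1).le
    rw [← mul_assoc, ← Real.exp_add, add_neg_cancel, Real.exp_zero, one_mul] at h3
    have he3 : Real.exp 1 ≤ 3 := by have := Real.exp_one_lt_d9; linarith
    nlinarith [he3]
  have hexpc : A * (luscherLambda β L ^ 2 / L) + (D * (luscherLambda β L / L) + Co * (luscherLambda β L / L) ^ 2) ≤
      c / (2 * L) := by
    have h1 : A * (luscherLambda β L ^ 2 / L) + (D * (luscherLambda β L / L) + Co * (luscherLambda β L / L) ^ 2) =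
        (A * luscherLambda β L ^ 2 + D * luscherLambda β L + Co * luscherLambda β L ^ 2 / L) / L := by
      field_simp
      ring
    rw [h1, div_le_div_iff₀ hLpos (by positivity)]
    nlinarith
  have hexpCK : Real.exp (CK * luscherLambda β L ^ 2 / L) ≤ Real.exp (A * (luscherLambda β L ^ 2 / L)) := by
    rw [Real.exp_le_exp, mul_div_assoc]
    exact mul_le_mul_of_nonneg_right hCKA hX0
  -- the exact vacuum, the penalty base point, the frame
  obtain ⟨Ω, θ, cΩ, hΩ, hcΩ, hΩge, hn, heig, -, -, -⟩ := PhysL2.exists_groundState (L := L) β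
  have hΩpos : ∀ U, 0 < Ω U := fun U => hcΩ.trans_le (hΩge U)
  obtain ⟨x₀, t, ht, HPEN⟩ := HS' L hLS β hwin Ω hΩ hΩpos heig
  obtain ⟨fs, hfs, hon, hdiag, hanti, hratio, hcap⟩ := HK' L hLK β hwin Ω hΩ hΩpos heig x₀ t ht HPEN
  clear HS' HK'
  have hsphys : ∀ i, IsPhys (fun U => flowLiftAt x₀ t (fs i) U * Ω U) := fun i => isPhys_slow hΩ x₀ t (hfs i)
  have hm0 : ∀ i, 0 ≤ qform su2Rep β (fun U => flowLiftAt x₀ t (fs i) U * Ω U) (fun U => flowLiftAt x₀ t (fs i) U * Ω U) :=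
    fun i => qform_su2Rep_self_nonneg hβ0 (hsphys i)
  -- (i) Rayleigh–Ritz on the frame: `m_k ≤ λ_k`
  have hRitz : qform su2Rep β (fun U => flowLiftAt x₀ t (fs (Fin.last k)) U * Ω U)
      (fun U => flowLiftAt x₀ t (fs (Fin.last k)) U * Ω U) ≤ levelValue su2Rep L β k := by
    have h := RitzInterlace.ritz_le_levelValue hβpos hsphys hon hdiag hanti (Fin.last k)
    simpa only [Fin.val_last] using h
  -- (ii) `m₀ ≤ λ₀`
  have hm0le : qform su2Rep β (fun U => flowLiftAt x₀ t (fs 0) U * Ω U) (fun U => flowLiftAt x₀ t (fs 0) U * Ω U) ≤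
      topValue su2Rep L β := by
    have hpos : 0 < l2 (fun U => flowLiftAt x₀ t (fs 0) U * Ω U) (fun U => flowLiftAt x₀ t (fs 0) U * Ω U) := by
      rw [hon 0 0, if_pos rfl]; exact one_pos
    have h := qform_le_levelValue_zero_mul su2Rep continuous_su2Rep β (hsphys 0) hpos
    rw [hon 0 0, if_pos rfl, mul_one, levelValue_zero] at h
    exact h
  -- (iii) CAPTURE at `j = 0` for the constant one-site function: `λ₀ ≤ e^{C_K Λ²/L} m₀`
  have hcap0 : topValue su2Rep L β ≤ Real.exp (CK * luscherLambda β L ^ 2 / L) *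
      qform su2Rep β (fun U => flowLiftAt x₀ t (fs 0) U * Ω U) (fun U => flowLiftAt x₀ t (fs 0) U * Ω U) := by
    have h := hcap 0 (fun _ => (1 : ℝ)) (isPhys_const 1) (fun i hi => absurd hi (Fin.not_lt_zero i))
    have h1 : (fun U => flowLiftAt x₀ t (fun _ : GaugeConfig 3 1 SU2 => (1 : ℝ)) U * Ω U) = Ω := by
      funext U; simp [flowLiftAt]
    rw [h1, qform_eq_l2_transferApply, heig, l2_comm, l2_smul_left, hn, mul_one, mul_one] at h
    exact h
  -- (iv) the stiff threshold lies below the slow level `k`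
  obtain ⟨hrat1, hrat2⟩ := hratio (Fin.last k)
  have hθ := stiff_below_slow hT0.le (hm0 0) (hm0 (Fin.last k)) hμ0pos hcap0 hrat2 hexpCK hε hOSlo hexpc
  -- (v) the upper Rayleigh bound
  have hupper : levelValue su2Rep L β k ≤ Real.exp (A * (luscherLambda β L ^ 2 / L)) *
      qform su2Rep β (fun U => flowLiftAt x₀ t (fs (Fin.last k)) U * Ω U) (fun U => flowLiftAt x₀ t (fs (Fin.last k)) U * Ω U) +
        |C₁| * (luscherLambda β L ^ 2 / L) * topValue su2Rep L β := by
    refine levelValue_le_of_pen_capture hΩ hcΩ hΩge x₀ t fs hfs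
      (θp := Real.exp (-c / (2 * L)) * topValue su2Rep L β)
      (Cpen := C₁ * (luscherLambda β L ^ 2 / L) * topValue su2Rep L β)
      (mcap := Real.exp (CK * luscherLambda β L ^ 2 / L) *
        qform su2Rep β (fun U => flowLiftAt x₀ t (fs (Fin.last k)) U * Ω U) (fun U => flowLiftAt x₀ t (fs (Fin.last k)) U * Ω U))
      HPEN (hcap (Fin.last k)) ?_ ?_ ?_
    · exact add_nonneg (mul_nonneg (Real.exp_pos _).le (hm0 _)) (mul_nonneg (mul_nonneg (abs_nonneg _) hX0) hT0.le)
    · exact hθ.trans (le_add_of_nonneg_right (mul_nonneg (mul_nonneg (abs_nonneg _) hX0) hT0.le))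
    · have h1 := mul_le_mul_of_nonneg_right hexpCK (hm0 (Fin.last k))
      have h2 : C₁ * (luscherLambda β L ^ 2 / L) * topValue su2Rep L β ≤ |C₁| * (luscherLambda β L ^ 2 / L) * topValue su2Rep L β :=
        mul_le_mul_of_nonneg_right (mul_le_mul_of_nonneg_right (le_abs_self _) hX0) hT0.le
      linarith
  -- (vi) bookkeeping
  have hfin := enclosure_arith hT0.le hμ0pos.le hμk0 (hm0 0) (hm0 (Fin.last k)) hX0 hA0 (Real.exp_pos _).le
    hRitz hm0le hcap0 hrat1 hrat2 hμ0le hexpCK hupper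
  rw [← levelValue_zero, ← mul_div_assoc] at hfin
  exact hfin

end Summit.QuantumFields.YangMills.Theorems.StiffComplementSchur

end
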